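import Summits.QuantumFields.YangMills.Theorems.UnitScaleTiltProp7AxialGaugeSup
import Summits.QuantumFields.YangMills.Theorems.UnitScaleTiltProp7CombGaugeIter
import Summits.QuantumFields.YangMills.Theorems.UnitScaleTiltProp7FlatHolonomy
import Literature.MathematicalPhysics.QuantumFieldTheory.Balaban1983to89.BlockAveragingEMLLinearisedBackground
import HarnessLib

/-!
# Route `UnitScaleTilt`, crux K1 child «MinimiserStabilityRegPr» (stmt-QuantumFields-19200), registered stub `stub_prop7From14` (skeleton birth_v7
# cc37a178…; leaf V3 «Prop 7 from a background (14)») — THE GEOMETRY OF THE `k`-FOLD COMB (relative position of a site from the centre of its `k`-block: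
# no wrap-around, `ℓ¹`-length `≤ d·(L^k − 1)`) AND THE HYPOTHESIS-FREE INTERIOR SUP BOUND `‖(W U₀⁻¹ − 1)_b‖ ≤ d(L^k − 1)(δ_W + δ₀)` for the comb-axial
# (4)-representative, `= O(d·ε₀·L^{−(K−n)})` at the carrier

Cell `ym3-torus` ∕ fleet seat `ym-ust-19200-p1` (gen 7; HUMAN RULING D-0037, YM ladder rung R3).  Completes this seat's `…Prop7AxialGauge` (the comb axial
gauge inside (4)) and `…Prop7AxialGaugeSup` (the relative axial bound `dist1(W_bU₀,b⁻¹) ≤ |x − y(x)|₁·(δ_W + δ₀)` on non-wrapping interior bonds) by the two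
geometric facts about the centre `y(x) = embIter k (iterBlockOf k x)` of the `k`-block of `x` that those files kept as hypotheses: the relative position
`rel y(x) x` IS the label difference (no wrap-around, every torus of the tower having at least two sites per direction, `Params.one_lt_sitesPerDir`), each
coordinate lies in `[−off, L^k − 1 − off]` with `2·off + 1 ≤ L^k` (`Prop7CombGauge.val_embIter_eq`), so `|x − y(x)|₁ ≤ d·(L^k − 1)` and the bond
`⟨x, μ⟩` never wraps relative to `y(x)`.  CONSEQUENCE (print's [Balaban1985RegularSpaces] Lemma 1 first half, «|V′_b − 1| < (d−1)(L−1)²α₀L⁻² for b ⊂ B(y)»,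
relative `k`-fold form with the AREA constant): for `W` in the complete `k`-fold comb axial gauge relative to `U₀`, plaquettes of `W`, `U₀` within `δ_W`, `δ₀`
of `1`, and EVERY bond with both endpoints in one `k`-block, `dist1(W_bU₀,b⁻¹) ≤ d·(L^k − 1)·(δ_W + δ₀)`; at the d = 3 carrier with print's plaquette clause
of (2) (`δ = e·L^{−2(K−n)}`): `‖pertVar U₀ W b‖ ≤ 3(e_W + e₀)·L^{−(K−n)}` — the `k`-UNIFORM `O(ε₀η)` sup-smallness of the (4)-axial representative in the
lineage's `pertVar` letters (`BlockAveragingEMLLinearisedBackground.pertVar`, `‖pertVar U₀ W b‖ = dist1(W_bU₀,b⁻¹)` definitionally).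

WHAT IS PROVED (sorry-free, no definition).
* §1 `rel_centre_eq` (∃ off, 2off+1 ≤ L^k ∧ rel y(x) x ν = (x_ν mod L^k) − off), `natAbs_rel_centre_le` (≤ L^k − 1), `l1_rel_centre_le` (≤ d(L^k − 1)),
  `noWrap_centre` ((rel y(x) x μ + 1)·2 ≤ N₀).
* §2 **`dist1_mul_inv_le_interior`** (any gauge group ∕ torus ∕ `k ≤ m + K`): comb-axial + plaquette-small + same `k`-block ⟹ `dist1(W_bU₀,b⁻¹) ≤ d(L^k − 1)(δ_W + δ₀)`.
* §3 **`norm_pertVar_le_interior_T3`**: at the carrier, `RegPr e_W W`, `RegPr e₀ U₀`, comb-axial, same `(K−n)`-block ⟹ `‖pertVar U₀ W b‖ ≤ 3(e_W + e₀)·L^{−(K−n)}`.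

HONEST SCOPE.  Interior bonds only (both endpoints in one `k`-block); the `2d·N_k^d·L^{k(d−1)}` bonds joining neighbouring blocks need the averaging constraint
([Balaban1985RegularSpaces] Lemma 1 (1.24)–(1.26), second half) — open.  The constant `d(L^k − 1)` is the crude `ℓ¹` diameter (the sharp comb-fan area is
`Σ_{κ after μ}|v_κ| ≤ (d−1)(L^k−1)/2·2`); no attempt at sharpness.

References: T. Bałaban, CMP 99 (1985) 75–102 [Balaban1985RegularSpaces] ((1.19), Lemma 1 (1.25) p.79); CMP 98 (1985) 17–51 [Balaban1985Averaging] (pp.24–25);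
CMP 102 (1985) 277–309 [Balaban1985Variational] ((2), (4) p.278, (15), (18) p.280); CMP 95 (1984) 17–40 [Balaban1984PropagatorsI] ((1.6)–(1.7) p.18).
-/

noncomputable section

namespace Summit.QuantumFields.YangMills.Theorems.Prop7AxialGaugeBlock

open scoped Matrix.Norms.L2Operator
open Literature.MathematicalPhysics.QuantumFieldTheory.Balaban1983to89
open T4Continuum BlockAveraging
open B10Eq27TorusAxialLog (axialT rel rel_apply)
open B7Prop1Explicit (l1)
open B5Eq118OneStroke (iterBlockOf val_iterBlockOf)
open B15DeterminingSets (embIter)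
open Summit.QuantumFields.YangMills.Theorems.Prop7CombGauge (val_embIter_eq)
open Summit.QuantumFields.YangMills.Theorems.Prop7FlatHolonomy (sitesPerDir_zero_eq_mul_pow)
open Summit.QuantumFields.YangMills.Theorems.Prop7AxialGaugeSup (dist1_mul_inv_le_of_combAxial)

/-! ## §1 The relative position of a site from the centre of its `k`-block -/

section Geometry

variable {P : Params} {k : ℕ}

/-- **THE RELATIVE POSITION FROM THE BLOCK CENTRE IS THE LABEL DIFFERENCE** (no wrap-around): for every site `x` of the finest torus and every coordinate `ν`
there is `off` with `2·off + 1 ≤ L^k` (the centre's offset inside the block, `Prop7CombGauge.val_embIter_eq`) such that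
`rel y(x) x ν = (x_ν mod L^k) − off`, `y(x) = embIter k (iterBlockOf k x)`. [cite: Balaban1984PropagatorsI, (1.6)-(1.7) p.18; Balaban1987RG1, (0.1) p.252] -/
theorem rel_centre_eq (hk : k ≤ P.m + P.K) (x : Site P 0) (ν : Fin P.d) :
    ∃ off : ℕ, 2 * off + 1 ≤ P.L ^ k ∧
      rel (embIter k (iterBlockOf k x)) x ν = (((x ν).val % P.L ^ k : ℕ) : ℤ) - (off : ℤ) := by
  obtain ⟨off, hoff, hle⟩ := val_embIter_eq k hk (iterBlockOf k x) ν
  refine ⟨off, hle, ?_⟩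
  rw [val_iterBlockOf k hk x ν] at hoff
  set N := P.sitesPerDir 0 with hN
  have hNpos : 0 < P.L ^ k := pow_pos P.L_pos k
  have hN2 : 2 * P.L ^ k ≤ N := by
    rw [hN, sitesPerDir_zero_eq_mul_pow hk]
    have h2 : 2 ≤ P.sitesPerDir k := P.one_lt_sitesPerDir k
    exact Nat.mul_le_mul_right _ h2
  -- label arithmetic in `ℤ`: `x_ν − y(x)_ν = (x_ν mod ℓ) − off`
  generalize hq : (x ν).val / P.L ^ k = q at hoff
  generalize hr : (x ν).val % P.L ^ k = r
  have hdm : (x ν).val = P.L ^ k * q + r := by rw [← hq, ← hr]; exact (Nat.div_add_mod _ _).symm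
  have hmod : r < P.L ^ k := by rw [← hr]; exact Nat.mod_lt _ hNpos
  have e1 : (((x ν).val : ℕ) : ℤ) = ((P.L ^ k : ℕ) : ℤ) * q + r := by exact_mod_cast hdm
  have e2 : (((embIter k (iterBlockOf k x) ν).val : ℕ) : ℤ) = (q : ℤ) * ((P.L ^ k : ℕ) : ℤ) + off := by exact_mod_cast hoff
  have hint : (((x ν).val : ℕ) : ℤ) - (((embIter k (iterBlockOf k x) ν).val : ℕ) : ℤ) = (r : ℤ) - (off : ℤ) := by
    linear_combination e1 - e2
  rw [rel_apply]
  apply (ZMod.valMinAbs_spec _ _).mpr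
  constructor
  · -- the two sides agree in `ZMod N`
    have hx : (x ν : ZMod N) = ((((x ν).val : ℕ) : ℤ) : ZMod N) := by rw [Int.cast_natCast, ZMod.natCast_zmod_val]
    have hc : ((embIter k (iterBlockOf k x)) ν : ZMod N) = ((((embIter k (iterBlockOf k x) ν).val : ℕ) : ℤ) : ZMod N) := by
      rw [Int.cast_natCast, ZMod.natCast_zmod_val]
    rw [hx, hc, ← Int.cast_sub, hint]
  · -- `2·((x mod ℓ) − off) ∈ (−N, N]`
    have hℓ2 : ((P.L ^ k : ℕ) : ℤ) * 2 ≤ (N : ℤ) := by exact_mod_cast (show P.L ^ k * 2 ≤ N by omega)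
    have hr' : (r : ℤ) + 1 ≤ ((P.L ^ k : ℕ) : ℤ) := by exact_mod_cast hmod
    have hoff' : (off : ℤ) * 2 + 1 ≤ ((P.L ^ k : ℕ) : ℤ) := by exact_mod_cast (show off * 2 + 1 ≤ P.L ^ k by omega)
    have hr0 : (0 : ℤ) ≤ r := by positivity
    have ho0 : (0 : ℤ) ≤ off := by positivity
    constructor <;> linarith

/-- Each relative coordinate from the block centre is at most `L^k − 1` in absolute value. [cite: Balaban1984PropagatorsI, (1.6) p.18] -/
theorem natAbs_rel_centre_le (hk : k ≤ P.m + P.K) (x : Site P 0) (ν : Fin P.d) :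
    (rel (embIter k (iterBlockOf k x)) x ν).natAbs ≤ P.L ^ k - 1 := by
  obtain ⟨off, hle, hrel⟩ := rel_centre_eq hk x ν
  have hmod : (x ν).val % P.L ^ k < P.L ^ k := Nat.mod_lt _ (pow_pos P.L_pos k)
  rw [hrel]
  generalize hr : (x ν).val % P.L ^ k = r at hmod
  generalize hℓ : P.L ^ k = ℓ at hmod hle
  omega

/-- **`|x − y(x)|₁ ≤ d·(L^k − 1)`**: the comb from the centre of a `k`-block to any of its sites has at most `d(L^k − 1)` bonds. [cite: Balaban1984PropagatorsI, (1.7) p.18] -/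
theorem l1_rel_centre_le (hk : k ≤ P.m + P.K) (x : Site P 0) :
    l1 (rel (embIter k (iterBlockOf k x)) x) ≤ P.d * (P.L ^ k - 1) := by
  unfold l1
  calc ∑ ν, (rel (embIter k (iterBlockOf k x)) x ν).natAbs ≤ ∑ _ν : Fin P.d, (P.L ^ k - 1) :=
        Finset.sum_le_sum fun ν _ => natAbs_rel_centre_le hk x ν
    _ = P.d * (P.L ^ k - 1) := by simp

/-- **NO WRAP-AROUND AT THE CENTRE**: `2·((x − y(x))_μ + 1) ≤ N₀` for every site and direction (the torus has at least two `k`-blocks per direction).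
[cite: Balaban1987RG1, (0.1) p.252] -/
theorem noWrap_centre (hk : k ≤ P.m + P.K) (x : Site P 0) (μ : Fin P.d) :
    (rel (embIter k (iterBlockOf k x)) x μ + 1) * 2 ≤ (P.sitesPerDir 0 : ℤ) := by
  obtain ⟨off, hle, hrel⟩ := rel_centre_eq hk x μ
  have hmod : (x μ).val % P.L ^ k < P.L ^ k := Nat.mod_lt _ (pow_pos P.L_pos k)
  have hN2 : 2 * P.L ^ k ≤ P.sitesPerDir 0 := by
    rw [sitesPerDir_zero_eq_mul_pow hk]
    exact Nat.mul_le_mul_right _ (P.one_lt_sitesPerDir k)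
  rw [hrel]
  generalize hr : (x μ).val % P.L ^ k = r at hmod
  have h1 : (r : ℤ) + 1 ≤ ((P.L ^ k : ℕ) : ℤ) := by exact_mod_cast hmod
  have h2 : ((P.L ^ k : ℕ) : ℤ) * 2 ≤ (P.sitesPerDir 0 : ℤ) := by exact_mod_cast (show P.L ^ k * 2 ≤ P.sitesPerDir 0 by omega)
  have h3 : (0 : ℤ) ≤ off := by positivity
  linarith

end Geometry

/-! ## §2 The hypothesis-free interior sup bound of the comb-axial (4)-representative -/

section Interior

variable {P : Params} {G : Type*} [GaugeGroup G] {k : ℕ}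

/-- **INTERIOR BONDS, EVERY GAUGE GROUP**: `W` in the complete `k`-fold comb axial gauge relative to `U₀` (same comb holonomies from the centre of every
`k`-block), plaquette variables of `W`, `U₀` within `δ_W, δ₀ ≥ 0` of `1`, both endpoints of `⟨x, μ⟩` in one `k`-block ⟹
`dist1(W_bU₀,b⁻¹) ≤ d·(L^k − 1)·(δ_W + δ₀)`. [cite: Balaban1985RegularSpaces, Lemma 1 (1.25) p.79; Balaban1985Averaging, pp.24-25] -/
theorem dist1_mul_inv_le_interior (hk : k ≤ P.m + P.K) (W U₀ : GaugeField P 0 G) {δW δ₀ : ℝ} (hδW : 0 ≤ δW) (hδ₀ : 0 ≤ δ₀)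
    (hW : PlaqSmall δW W) (hU₀ : PlaqSmall δ₀ U₀)
    (hax : ∀ x : Site P 0, axialT W (embIter k (iterBlockOf k x)) x = axialT U₀ (embIter k (iterBlockOf k x)) x)
    (x : Site P 0) (μ : Fin P.d) (hblock : iterBlockOf k (x.shift μ) = iterBlockOf k x) :
    dist1 (W ⟨x, μ⟩ * (U₀ ⟨x, μ⟩)⁻¹) ≤ (P.d : ℝ) * ((P.L : ℝ) ^ k - 1) * (δW + δ₀) := by
  have h := dist1_mul_inv_le_of_combAxial W U₀ hδW hδ₀ hW hU₀ hax x μ hblock (noWrap_centre hk x μ)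
  refine h.trans (mul_le_mul_of_nonneg_right ?_ (add_nonneg hδW hδ₀))
  have hl := l1_rel_centre_le hk x
  have hL1 : 1 ≤ P.L ^ k := Nat.one_le_pow _ _ P.L_pos
  have hcast : ((P.d * (P.L ^ k - 1) : ℕ) : ℝ) = (P.d : ℝ) * ((P.L : ℝ) ^ k - 1) := by
    rw [Nat.cast_mul, Nat.cast_sub hL1]; push_cast; ring
  rw [← hcast]
  exact_mod_cast hl

end Interior

/-! ## §3 At the d = 3 carrier, in the lineage's `pertVar` letters -/

section T3

open Literature.MathematicalPhysics.QuantumFieldTheory.Balaban1983to89.T3ContinuumYM3Torus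
open Literature.MathematicalPhysics.QuantumFieldTheory.Balaban1983to89.T3RegularMinimiser (regThreshold)
open Literature.MathematicalPhysics.QuantumFieldTheory.Balaban1983to89.T3PrintedRegularMinimiser (RegPr RegPr.plaqSmall)
open BlockAveragingEMLLinearisedBackground (pertVar)

variable (F : T3Family) (n K : ℕ)

/-- **THE `k`-UNIFORM `O(ε₀η)` SUP-SMALLNESS OF THE (4)-AXIAL REPRESENTATIVE ON INTERIOR BONDS, AT THE CARRIER**: `W ∈ 𝔘_k(e_W)`, `U₀ ∈ 𝔘_k(e₀)` (print's
(2), plaquette clause), `W` in the complete `(K−n)`-fold comb axial gauge relative to `U₀` (reached inside the group (4) by `Prop7AxialGauge.exists_axialGauge_T3`),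
and a bond with both endpoints in one `(K−n)`-block ⟹ `‖pertVar U₀ W b‖ ≤ 3·(e_W + e₀)·L^{−(K−n)}` (`= ‖W_bU₀,b* − 1‖`; `d = 3`; `η = L^{−(K−n)}`).
[cite: Balaban1985Variational, (2) p.278, (18) p.280; Balaban1985RegularSpaces, Lemma 1 (1.25) p.79] -/
theorem norm_pertVar_le_interior_T3 {eW e₀ : ℝ} (heW : 0 ≤ eW) (he₀ : 0 ≤ e₀)
    (W U₀ : GaugeField (F.P K) 0 (Matrix.specialUnitaryGroup (Fin 2) ℂ)) (hW : RegPr F n K eW W) (hU₀ : RegPr F n K e₀ U₀)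
    (hax : ∀ x : Site (F.P K) 0, axialT W (embIter (K - n) (iterBlockOf (K - n) x)) x = axialT U₀ (embIter (K - n) (iterBlockOf (K - n) x)) x)
    (x : Site (F.P K) 0) (μ : Fin (F.P K).d) (hblock : iterBlockOf (K - n) (x.shift μ) = iterBlockOf (K - n) x) :
    ‖pertVar U₀ W ⟨x, μ⟩‖ ≤ 3 * (eW + e₀) * (((F.L : ℝ))⁻¹) ^ (K - n) := by
  have hL1 : (1 : ℝ) ≤ (F.L : ℝ) := by exact_mod_cast F.hL.2.le
  have hL0 : (0 : ℝ) < (F.L : ℝ) := by linarith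
  have hpos : 0 ≤ (((F.L : ℝ))⁻¹) ^ (2 * (K - n)) := pow_nonneg (inv_nonneg.mpr hL0.le) _
  have h := dist1_mul_inv_le_interior (k := K - n) (by show K - n ≤ F.m + K; omega) W U₀ (mul_nonneg heW hpos) (mul_nonneg he₀ hpos)
    (RegPr.plaqSmall hW) (RegPr.plaqSmall hU₀) hax x μ hblock
  have hd : ((F.P K).d : ℝ) = 3 := by rw [T3Family.P_d]; norm_num
  change dist1 (W ⟨x, μ⟩ * (U₀ ⟨x, μ⟩)⁻¹) ≤ _
  refine h.trans ?_
  rw [hd]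
  -- `3(ℓ − 1)·(e_W + e₀)·L^{−2(K−n)} ≤ 3(e_W + e₀)·L^{−(K−n)}` since `(ℓ − 1)·ℓ⁻² ≤ ℓ⁻¹`, `ℓ = L^{K−n}`
  have hsum : 0 ≤ eW + e₀ := add_nonneg heW he₀
  have hl : ((F.L : ℝ) ^ (K - n) - 1) * (((F.L : ℝ))⁻¹) ^ (2 * (K - n)) ≤ (((F.L : ℝ))⁻¹) ^ (K - n) := by
    have hℓ : (1 : ℝ) ≤ (F.L : ℝ) ^ (K - n) := one_le_pow₀ hL1
    have hℓpos : (0 : ℝ) < (F.L : ℝ) ^ (K - n) := by linarith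
    have ht : ((F.L : ℝ)⁻¹) ^ (K - n) = ((F.L : ℝ) ^ (K - n))⁻¹ := inv_pow _ _
    rw [pow_mul', ht]
    set ℓ : ℝ := (F.L : ℝ) ^ (K - n) with hℓdef
    have hinv : 0 ≤ ℓ⁻¹ := inv_nonneg.mpr hℓpos.le
    have h1 : (ℓ - 1) * ℓ⁻¹ ≤ 1 := by
      rw [sub_mul, mul_inv_cancel₀ hℓpos.ne']
      linarith
    calc (ℓ - 1) * (ℓ⁻¹) ^ 2 = ((ℓ - 1) * ℓ⁻¹) * ℓ⁻¹ := by ring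
      _ ≤ 1 * ℓ⁻¹ := mul_le_mul_of_nonneg_right h1 hinv
      _ = ℓ⁻¹ := one_mul _
  calc (3 : ℝ) * ((F.L : ℝ) ^ (K - n) - 1) * (eW * ((F.L : ℝ)⁻¹) ^ (2 * (K - n)) + e₀ * ((F.L : ℝ)⁻¹) ^ (2 * (K - n)))
      = 3 * (eW + e₀) * (((F.L : ℝ) ^ (K - n) - 1) * (((F.L : ℝ))⁻¹) ^ (2 * (K - n))) := by ring
    _ ≤ 3 * (eW + e₀) * (((F.L : ℝ))⁻¹) ^ (K - n) := mul_le_mul_of_nonneg_left hl (by positivity)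

end T3

end Summit.QuantumFields.YangMills.Theorems.Prop7AxialGaugeBlock

end
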